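import Literature.NumberTheory.Weil1964.ArchVacuumSection
import Literature.Analysis.SegalBargmann.SchwartzHeisenbergSchur
import HarnessLib

/-!
# The archimedean Weil datum of a coefficient-continuous covariant representation (Folland 1989, §4.2, the Schur remark)

Topic `NumberTheory/Weil1964`; namespace `Literature.NumberTheory.Weil1964`.  Continuation of
`ArchWeilContinuityKAK` / `ArchVacuumSection`.  KERNEL MATHEMATICS ONLY: proved theorems; no definition, no `def … : Prop` record, no axiom, no proof hole.

**The point of this file.**  `ArchWeilContinuityKAK.isArchWeilDatum_of_kak` derives (w1) of `IsArchWeilDatum` for a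
representation `ω : G → End 𝓢(ℝ^σ)` from (w2) + (w2′) + `KAK` data + the continuity of the VACUUM ORBIT of `ω`.
A representation READ OFF an adelic one (`AdelicMetaplecticArchRep.archRepMp`, the archimedean factor `ω_∞(g) ⊗ 1 =
ω_ψ(s g)` of [Weil1964, n° 37–38]) comes with a different and much weaker piece of analytic information: its MATRIX
COEFFICIENTS AT POINTS `g ↦ (ω g f)(x)` are continuous (`AdelicMetaplecticArchRepCovariant.continuous_archRepMp_apply_apply`,
the topology of `Mp_ψ(W_𝔸)`), and NO unitarity ((w2′) is not recorded by the adelic implementer group).  This file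
shows that this is enough:

* §1 lift-free Schur against a continuous covariant operator (`exists_eq_smul_of_covariant_equiv`: a continuous operator
  covariant over the same phase-space map as a covariant topological AUTOMORPHISM is a scalar multiple of it — Schur's
  lemma `SchwartzHeisenbergSchur.eq_smul_of_commute_rhoS` applied to `M⁻¹ ∘ N`);
* §3 given `KAK` implementer data `D : KAKImplementerData γ κ a W_K W_A` on a monoid `G′` (its canonical
  vacuum-normalised section `vacSection γ`: (w0) non-zero, (w1) strongly continuous, (w2) covariant, (w2′) unitary
  lifts — `ArchVacuumSection`) and a continuous map `ϖ : G → G′` such that `ω` is Heisenberg-covariant over `γ ∘ ϖ`: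
  `ω g = c(g) • vacSection γ (ϖ g)` for a nowhere-vanishing function `c : G → ℂ` (`exists_coeff`, `coeff_ne_zero`, `eq_coeff`; every later statement is parametric in any such `c`);
* §4 **(w1) from POINTWISE COEFFICIENT CONTINUITY**: if every `g ↦ (ω g f)(x)` is continuous then `c` is continuous
  (`continuous_coeff`: near `g₀`, `c = (ω g h₀)(x₀) / (vacSection (ϖ g) h₀)(x₀)` at a point `x₀` where the
  denominator does not vanish) and hence every orbit map `g ↦ ω g f` is continuous into the Fréchet space `𝓢(ℝ^σ)`,
  indeed `(g, f) ↦ ω g f` is jointly continuous (`continuous_apply_of_coeff`, `continuous_uncurry_of_coeff`) — no Weyl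
  element and no vacuum character OF `ω` is needed;
* §5 **the modulus character**: `g ↦ ‖c g‖` is multiplicative with `‖c 1‖ = 1` (`norm_coeff_mul`: Schur WITH
  lifts for `vacSection (ϖ g) ∘ vacSection (ϖ h)` against `vacSection (ϖ (g h))`, `IsImplementerS.exists_eq_smul`) —
  a continuous positive multiplicative function on `G`;
* §6 **(w2′)**: `ω g` has a unitary lift iff `‖c g‖ = 1` (`hasUnitaryLift_of_norm_coeff`,
  `norm_coeff_of_hasUnitaryLift`); so (w2′) for all `g` ⇔ `G` carries no non-trivial continuous positive
  multiplicative function through `‖c‖`, and **`isArchWeilDatum_of_coeff`** assembles the datum over any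
  `ι𝕎 : G →* Sp(ℝ^σ × ℝ^σ)` with `⇑(ι𝕎 g) = γ (ϖ g)`;
* §2 discharge lemmas for "no non-trivial continuous positive multiplicative function": compact groups
  (`mulPos_eq_one_of_compactSpace`), the inverse-conjugate / Weyl relation `w a w⁻¹ = a⁻¹` (`mulPos_eq_one_of_conj_eq_inv`),
  `K·A·K` word-surjective groups (`mulPos_eq_one_of_kak`), binary and finite products (`mulPos_prod_eq_one`,
  `mulPos_pi_eq_one`).

Everything is PROVED from Mathlib and the imported tree files; no cited statement is a hypothesis.

## References

* [Folland1989] G. B. Folland, *Harmonic Analysis in Phase Space*, Annals of Mathematics Studies 122, Princeton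
  University Press, 1989: §1.4 Prop. (1.43) (irreducibility of `ρ`), §4.2 (4.23)–(4.24) and the Schur remark p. 156
  ("`μ(𝒜)` is determined up to a phase factor"), Prop. (4.39) (doi:10.1515/9781400882427).
* [Weil1964] A. Weil, *Sur certains groupes d'opérateurs unitaires*, Acta Math. 111 (1964) 143–211, Chap. III
  n° 37–39 pp. 188–190 (`𝐫_𝐀 = ⊗_v 𝐫_v`; the topology of `Mp_𝐀`).
* [Knapp2002] A. W. Knapp, *Lie Groups Beyond an Introduction*, 2nd ed., Progress in Mathematics 140, Birkhäuser,
  2002: Theorem 7.39 (`G = K A K`), p. 457.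

## Provenance

LEAN-IN-TREE rule (2026-08-18), pub-hodgecm model-construction sub-cell, discharge seat mc-discharge-3 (ticket D-3:
(J-arch) (w1)/(w2′) of the read-off archimedean Weil representation of the pinned splitting; BINDER-OWNERS §1a rows
10/16/17 sub-items (c2)/(c4)).  Nothing here is a claim of the manuscripts adjudicated by that cell.
-/

noncomputable section

open MeasureTheory Complex SchwartzMap Filter Topology
open scoped InnerProductSpace ComplexConjugate Real

namespace Literature.NumberTheory.Weil1964

open Literature.Analysis.SegalBargmann Literature.RepresentationTheory.HeisenbergGroup

variable {σ : Type*} [Fintype σ] [DecidableEq σ]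

/-! ## 1. Lift-free Schur against a covariant topological automorphism -/

section Schur

omit [DecidableEq σ] in
/-- point evaluation `F ↦ F x` is continuous on `𝓢(ℝ^σ)`. [folklore] -/
theorem continuous_schwartz_eval (x : σ → ℝ) : Continuous fun F : SchwartzMap (σ → ℝ) ℂ => F x :=
  ((BoundedContinuousFunction.evalCLM ℂ x).comp (SchwartzMap.toBoundedContinuousFunctionCLM ℂ (σ → ℝ) ℂ)).continuous

/-- **Lift-free Schur against a covariant automorphism.**  If a topological automorphism `M` of `𝓢(ℝ^σ)` and a
continuous operator `N` are both Heisenberg-covariant over the SAME phase-space map `φ`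
(`X ∘ ρ(p,q) = ρ(φ(p,q)) ∘ X`), then `N = c • M` for a scalar `c` (`M⁻¹ ∘ N` commutes with every `ρ(p,q)`; Schur's
lemma for `ρ` on `𝓢`, `SchwartzHeisenbergSchur.eq_smul_of_commute_rhoS`).  No unitarity and no bijectivity of `φ`
is used. [cite: Folland1989, §4.2, the Schur remark p. 156] -/
theorem exists_eq_smul_of_covariant_equiv (φ : PhaseMap σ) (M : (SchwartzMap (σ → ℝ) ℂ) ≃L[ℂ] SchwartzMap (σ → ℝ) ℂ) (N : (SchwartzMap (σ → ℝ) ℂ) →L[ℂ] SchwartzMap (σ → ℝ) ℂ)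
    (hM : ∀ (p q : σ → ℝ) (f : SchwartzMap (σ → ℝ) ℂ), M (rhoS p q f) = rhoS (φ (p, q)).1 (φ (p, q)).2 (M f))
    (hN : ∀ (p q : σ → ℝ) (f : SchwartzMap (σ → ℝ) ℂ), N (rhoS p q f) = rhoS (φ (p, q)).1 (φ (p, q)).2 (N f)) :
    ∃ c : ℂ, ∀ f : SchwartzMap (σ → ℝ) ℂ, N f = c • M f := by
  let T : (SchwartzMap (σ → ℝ) ℂ) →L[ℂ] SchwartzMap (σ → ℝ) ℂ := ((M.symm : (SchwartzMap (σ → ℝ) ℂ) ≃L[ℂ] SchwartzMap (σ → ℝ) ℂ) : (SchwartzMap (σ → ℝ) ℂ) →L[ℂ] SchwartzMap (σ → ℝ) ℂ).comp N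
  have hTapp : ∀ f, T f = M.symm (N f) := fun f => rfl
  have hsymm : ∀ (p q : σ → ℝ) (g : SchwartzMap (σ → ℝ) ℂ),
      M.symm (rhoS (φ (p, q)).1 (φ (p, q)).2 g) = rhoS p q (M.symm g) := by
    intro p q g
    apply M.injective
    rw [ContinuousLinearEquiv.apply_symm_apply, hM, ContinuousLinearEquiv.apply_symm_apply]
  have hT : ∀ (p q : σ → ℝ) (f : SchwartzMap (σ → ℝ) ℂ), T (rhoS p q f) = rhoS p q (T f) := by
    intro p q f
    rw [hTapp, hTapp, hN, hsymm]
  refine ⟨schurCoeff T, fun f => ?_⟩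
  have h1 := eq_smul_of_commute_rhoS T hT f
  rw [hTapp] at h1
  have h2 := congrArg M h1
  rwa [ContinuousLinearEquiv.apply_symm_apply, map_smul] at h2

end Schur

/-! ## 2. Groups without non-trivial continuous positive multiplicative functions -/

section PosChar

variable {G : Type*} [Group G]

/-- `n 1 = 1` for a positive multiplicative function. [folklore] -/
theorem mulPos_map_one {n : G → ℝ} (hn : ∀ g h, n (g * h) = n g * n h) (hpos : ∀ g, 0 < n g) : n 1 = 1 := by
  have h1 := hn 1 1
  rw [mul_one] at h1
  exact (mul_right_eq_self₀.1 h1.symm).resolve_right (hpos 1).ne'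

/-- `n g⁻¹ = (n g)⁻¹` for a positive multiplicative function. [folklore] -/
theorem mulPos_map_inv {n : G → ℝ} (hn : ∀ g h, n (g * h) = n g * n h) (hpos : ∀ g, 0 < n g) (g : G) :
    n g⁻¹ = (n g)⁻¹ := by
  have h1 := hn g g⁻¹
  rw [mul_inv_cancel, mulPos_map_one hn hpos] at h1
  exact eq_inv_of_mul_eq_one_right h1.symm

/-- `n (g ^ m) = (n g) ^ m`. [folklore] -/
theorem mulPos_map_pow {n : G → ℝ} (hn : ∀ g h, n (g * h) = n g * n h) (hpos : ∀ g, 0 < n g) (g : G) (m : ℕ) :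
    n (g ^ m) = n g ^ m := by
  induction m with
  | zero => rw [pow_zero, pow_zero, mulPos_map_one hn hpos]
  | succ m ih => rw [pow_succ, hn, ih, pow_succ]

/-- **A compact group has no non-trivial continuous positive multiplicative function** (the image is a bounded
subgroup of `ℝ_{>0}`). [folklore] -/
theorem mulPos_eq_one_of_compactSpace [TopologicalSpace G] [CompactSpace G] (n : G → ℝ)
    (hn : ∀ g h, n (g * h) = n g * n h) (hpos : ∀ g, 0 < n g) (hcont : Continuous n) (g : G) : n g = 1 := by
  obtain ⟨M, hM⟩ := (isCompact_range hcont).bddAbove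
  have hM' : ∀ g, n g ≤ M := fun g => hM ⟨g, rfl⟩
  -- no value exceeds `1`
  have hle : ∀ g, n g ≤ 1 := fun g => by
    by_contra hlt
    push Not at hlt
    obtain ⟨m, hm⟩ := pow_unbounded_of_one_lt M hlt
    rw [← mulPos_map_pow hn hpos] at hm
    exact (lt_irrefl M) (lt_of_lt_of_le hm (hM' _))
  refine le_antisymm (hle g) ?_
  have h1 := hle g⁻¹
  rw [mulPos_map_inv hn hpos] at h1
  exact (inv_le_one₀ (hpos g)).1 h1

/-- **An element conjugate to its inverse is killed**: `w x w⁻¹ = x⁻¹ ⇒ n x = 1` (the Weyl-element relation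
`w a_t w⁻¹ = a_{-t}` of a split torus). [folklore] -/
theorem mulPos_eq_one_of_conj_eq_inv {n : G → ℝ} (hn : ∀ g h, n (g * h) = n g * n h) (hpos : ∀ g, 0 < n g)
    {w x : G} (h : w * x * w⁻¹ = x⁻¹) : n x = 1 := by
  have h1 : n (w * x * w⁻¹) = n x := by
    rw [hn, hn, mulPos_map_inv hn hpos, mul_assoc, mul_comm (n x), ← mul_assoc, mul_inv_cancel₀ (hpos w).ne',
      one_mul]
  rw [h, mulPos_map_inv hn hpos] at h1
  have h2 : n x * n x = 1 := by
    calc n x * n x = n x * (n x)⁻¹ := by rw [h1]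
      _ = 1 := mul_inv_cancel₀ (hpos x).ne'
  exact (mul_self_eq_one_iff.1 h2).resolve_right fun h3 => by linarith [hpos x]

/-- **`K·A·K` groups**: if `κ : K →* G` is a continuous homomorphism from a compact group, `a : P → G` any family on
which `n` is trivial (e.g. by `mulPos_eq_one_of_conj_eq_inv`), and the word map `(k₁, t, k₂) ↦ κ k₁ · a t · κ k₂`
is onto, then every continuous positive multiplicative `n` on `G` is trivial. [cite: Knapp2002, Thm 7.39] -/
theorem mulPos_eq_one_of_kak [TopologicalSpace G] {K : Type*} [Group K] [TopologicalSpace K] [CompactSpace K]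
    {P : Type*} (κ : K →* G) (hκ : Continuous κ) (a : P → G)
    (hsurj : Function.Surjective fun p : K × P × K => κ p.1 * a p.2.1 * κ p.2.2)
    (n : G → ℝ) (hn : ∀ g h, n (g * h) = n g * n h) (hpos : ∀ g, 0 < n g) (hcont : Continuous n)
    (hA : ∀ t, n (a t) = 1) (g : G) : n g = 1 := by
  have hK : ∀ k, n (κ k) = 1 :=
    mulPos_eq_one_of_compactSpace (fun k => n (κ k)) (fun k k' => by rw [map_mul, hn]) (fun k => hpos _)
      (hcont.comp hκ)
  obtain ⟨⟨k₁, t, k₂⟩, rfl⟩ := hsurj g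
  simp only [hn, hK, hA, mul_one]

/-- **Binary products**: if `G₁` and `G₂` carry no non-trivial continuous positive multiplicative function, neither
does `G₁ × G₂`. [folklore] -/
theorem mulPos_prod_eq_one {G₁ G₂ : Type*} [Group G₁] [Group G₂] [TopologicalSpace G₁] [TopologicalSpace G₂]
    (h₁ : ∀ n : G₁ → ℝ, (∀ g h, n (g * h) = n g * n h) → (∀ g, 0 < n g) → Continuous n → ∀ g, n g = 1)
    (h₂ : ∀ n : G₂ → ℝ, (∀ g h, n (g * h) = n g * n h) → (∀ g, 0 < n g) → Continuous n → ∀ g, n g = 1)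
    (n : G₁ × G₂ → ℝ) (hn : ∀ g h, n (g * h) = n g * n h) (hpos : ∀ g, 0 < n g) (hcont : Continuous n)
    (g : G₁ × G₂) : n g = 1 := by
  have e : g = ((g.1, 1) : G₁ × G₂) * (1, g.2) := by ext <;> simp
  rw [e, hn,
    h₁ (fun x => n (x, 1)) (fun x y => by rw [← hn, Prod.mk_mul_mk, mul_one]) (fun x => hpos _)
      (hcont.comp (continuous_id.prodMk continuous_const)) g.1,
    h₂ (fun y => n (1, y)) (fun x y => by rw [← hn, Prod.mk_mul_mk, mul_one]) (fun y => hpos _)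
      (hcont.comp (continuous_const.prodMk continuous_id)) g.2, mul_one]

/-- **Finite products**: if no factor `H i` carries a non-trivial continuous positive multiplicative function,
neither does `Π i, H i`. [folklore] -/
theorem mulPos_pi_eq_one {ι : Type*} [Fintype ι] [DecidableEq ι] {H : ι → Type*} [∀ i, Group (H i)]
    [∀ i, TopologicalSpace (H i)]
    (h : ∀ i, ∀ n : H i → ℝ, (∀ g g', n (g * g') = n g * n g') → (∀ g, 0 < n g) → Continuous n → ∀ g, n g = 1)
    (n : (∀ i, H i) → ℝ) (hn : ∀ g g', n (g * g') = n g * n g') (hpos : ∀ g, 0 < n g) (hcont : Continuous n)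
    (g : ∀ i, H i) : n g = 1 := by
  have hsingle : ∀ i (x : H i), n (Pi.mulSingle i x) = 1 := fun i =>
    h i (fun x => n (Pi.mulSingle i x)) (fun x y => by rw [← hn, Pi.mulSingle_mul]) (fun x => hpos _)
      (hcont.comp (continuous_mulSingle i))
  suffices hs : ∀ s : Finset ι, n (fun i => if i ∈ s then g i else 1) = 1 by
    have h1 := hs Finset.univ
    simpa only [Finset.mem_univ, if_true] using h1
  intro s
  induction s using Finset.induction_on with
  | empty =>
    simp only [Finset.notMem_empty, if_false]
    exact mulPos_map_one hn hpos
  | insert i s hi ih =>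
    have hdecomp : (fun j => if j ∈ insert i s then g j else 1) =
        Pi.mulSingle i (g i) * fun j => if j ∈ s then g j else 1 := by
      funext j
      by_cases hj : j = i
      · subst hj
        simp only [Finset.mem_insert, true_or, if_true, Pi.mul_apply, Pi.mulSingle_eq_same, hi, if_false,
          mul_one]
      · simp only [Finset.mem_insert, hj, false_or, Pi.mul_apply, Pi.mulSingle_eq_of_ne hj, one_mul]
    rw [hdecomp, hn, hsingle, one_mul, ih]

end PosChar

/-! ## 3. The coefficient of a covariant representation against the vacuum-normalised section -/

section Coeff

variable {G : Type*} [Group G] [TopologicalSpace G]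
variable {G' : Type*} [Monoid G'] [TopologicalSpace G'] {K : Type*} [TopologicalSpace K] {P : Type*}
  [TopologicalSpace P]
variable {γ : G' → PhaseMap σ} {κ : K → G'} {a : P → G'} {WK : K → ((SchwartzMap (σ → ℝ) ℂ) →L[ℂ] SchwartzMap (σ → ℝ) ℂ)}
  {WA : P → ((SchwartzMap (σ → ℝ) ℂ) →L[ℂ] SchwartzMap (σ → ℝ) ℂ)}

omit [DecidableEq σ] [TopologicalSpace G] in
/-- The operators `ω g` of a representation with continuous operators, as topological automorphisms of `𝓢(ℝ^σ)`
(inverse `ω g⁻¹`). [folklore] -/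
theorem exists_continuousLinearEquiv_coe_eq (ω : Representation ℂ G (SchwartzMap (σ → ℝ) ℂ)) (hc : ∀ g, Continuous (ω g)) (g : G) :
    ∃ M : (SchwartzMap (σ → ℝ) ℂ) ≃L[ℂ] SchwartzMap (σ → ℝ) ℂ, ∀ f, M f = ω g f := by
  have h1 : (ω g).comp (ω g⁻¹) = LinearMap.id := by
    rw [← Module.End.mul_eq_comp, ← map_mul, mul_inv_cancel, map_one]; rfl
  have h2 : (ω g⁻¹).comp (ω g) = LinearMap.id := by
    rw [← Module.End.mul_eq_comp, ← map_mul, inv_mul_cancel, map_one]; rfl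
  exact ⟨{ toLinearEquiv := LinearEquiv.ofLinear (ω g) (ω g⁻¹) h1 h2
           continuous_toFun := hc g
           continuous_invFun := hc g⁻¹ }, fun _ => rfl⟩

omit [TopologicalSpace G] in
/-- **The representation is a scalar multiple of the section**: for `ω` with continuous operators, covariant over
`γ ∘ ϖ`, and `KAK` implementer data for `γ`, there is for each `g` a scalar `c ≠ 0` with
`ω g f = c • vacSection γ (ϖ g) f`. [cite: Folland1989, §4.2, the Schur remark p. 156] -/
theorem exists_apply_eq_smul_vacSection (D : KAKImplementerData γ κ a WK WA) (ω : Representation ℂ G (SchwartzMap (σ → ℝ) ℂ))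
    (hc : ∀ g, Continuous (ω g)) (ϖ : G → G') (hcov : IsPhaseCovariantS (fun g => γ (ϖ g)) (fun g => ω g))
    (g : G) : ∃ c : ℂ, c ≠ 0 ∧ ∀ f : SchwartzMap (σ → ℝ) ℂ, ω g f = c • vacSection γ (ϖ g) f := by
  obtain ⟨M, hM⟩ := exists_continuousLinearEquiv_coe_eq ω hc g
  have hMcov : ∀ (p q : σ → ℝ) (f : SchwartzMap (σ → ℝ) ℂ),
      M (rhoS p q f) = rhoS (γ (ϖ g) (p, q)).1 (γ (ϖ g) (p, q)).2 (M f) := fun p q f => by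
    rw [hM, hM]; exact hcov g p q f
  obtain ⟨c', hc'⟩ := exists_eq_smul_of_covariant_equiv (γ (ϖ g)) M (vacSection γ (ϖ g)) hMcov
    (D.isImplementerS_vacSection (ϖ g)).1
  have hc'0 : c' ≠ 0 := by
    intro h0
    apply D.vacSection_ne_zero (ϖ g)
    exact ContinuousLinearMap.ext fun f => by rw [hc' f, h0, zero_smul]; rfl
  refine ⟨c'⁻¹, inv_ne_zero hc'0, fun f => ?_⟩
  rw [hc' f, hM, smul_smul, inv_mul_cancel₀ hc'0, one_smul]

omit [TopologicalSpace G] in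
/-- **The coefficient function**: `ω g = c(g) • vacSection γ (ϖ g)` for a function `c : G → ℂ` (unique by
`eq_coeff`; all later statements are parametric in any such `c`). [cite: Folland1989, §4.2, the Schur remark p. 156] -/
theorem exists_coeff (D : KAKImplementerData γ κ a WK WA) (ω : Representation ℂ G (SchwartzMap (σ → ℝ) ℂ))
    (hc : ∀ g, Continuous (ω g)) (ϖ : G → G') (hcov : IsPhaseCovariantS (fun g => γ (ϖ g)) (fun g => ω g)) :
    ∃ c : G → ℂ, ∀ (g : G) (f : SchwartzMap (σ → ℝ) ℂ), ω g f = c g • vacSection γ (ϖ g) f := by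
  choose c _ hc' using exists_apply_eq_smul_vacSection D ω hc ϖ hcov
  exact ⟨c, hc'⟩

omit [TopologicalSpace G] in
/-- Uniqueness of the coefficient: `ω g f = c′ • vacSection γ (ϖ g) f` for ONE `f ≠ 0` forces `c′ = c(g)`.
[cite: Folland1989, §4.2, the Schur remark p. 156] -/
theorem eq_coeff (D : KAKImplementerData γ κ a WK WA) (ω : Representation ℂ G (SchwartzMap (σ → ℝ) ℂ)) (ϖ : G → G')
    {c : G → ℂ} (hcω : ∀ (g : G) (f : SchwartzMap (σ → ℝ) ℂ), ω g f = c g • vacSection γ (ϖ g) f)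
    {g : G} {c' : ℂ} {f : SchwartzMap (σ → ℝ) ℂ} (hf : f ≠ 0) (h : ω g f = c' • vacSection γ (ϖ g) f) : c' = c g := by
  rw [hcω g f] at h
  exact (smul_left_injective ℂ (D.vacSection_apply_ne_zero (ϖ g) hf) h).symm

omit [TopologicalSpace G] [Monoid G'] [TopologicalSpace G'] in
/-- `c(g) ≠ 0` (the operators of a representation of a group are injective). [folklore] -/
theorem coeff_ne_zero (ω : Representation ℂ G (SchwartzMap (σ → ℝ) ℂ)) (ϖ : G → G')
    {c : G → ℂ} (hcω : ∀ (g : G) (f : SchwartzMap (σ → ℝ) ℂ), ω g f = c g • vacSection γ (ϖ g) f) (g : G) :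
    c g ≠ 0 := by
  intro h0
  have h1 : ω g (hermitePi 0) = 0 := by rw [hcω, h0, zero_smul]
  have h2 : ω g⁻¹ (ω g (hermitePi 0)) = hermitePi 0 := by
    rw [← Module.End.mul_apply, ← map_mul, inv_mul_cancel, map_one, Module.End.one_apply]
  rw [h1, map_zero] at h2
  exact hermitePi_zero_ne_zero h2.symm

/-! ## 4. (w1) from pointwise coefficient continuity -/

/-- **The coefficient is continuous when the matrix coefficients at points are.**  Near `g₀`,
`c(g) = (ω g h₀)(x₀) / (vacSection γ (ϖ g) h₀)(x₀)` at a point `x₀` with `(vacSection γ (ϖ g₀) h₀)(x₀) ≠ 0`;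
numerator continuous by hypothesis, denominator by the strong continuity of the section.
[cite: Folland1989, §4.2, the Schur remark p. 156] -/
theorem continuous_coeff (D : KAKImplementerData γ κ a WK WA) (ω : Representation ℂ G (SchwartzMap (σ → ℝ) ℂ))
    (ϖ : G → G') (hϖ : Continuous ϖ)
    {c : G → ℂ} (hcω : ∀ (g : G) (f : SchwartzMap (σ → ℝ) ℂ), ω g f = c g • vacSection γ (ϖ g) f)
    (hcoef : ∀ (f : SchwartzMap (σ → ℝ) ℂ) (x : σ → ℝ), Continuous fun g => ω g f x) : Continuous c := by
  set f : SchwartzMap (σ → ℝ) ℂ := hermitePi 0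
  refine continuous_iff_continuousAt.2 fun g₀ => ?_
  have hN0 : vacSection γ (ϖ g₀) f ≠ 0 := D.vacSection_apply_ne_zero (ϖ g₀) hermitePi_zero_ne_zero
  obtain ⟨x₀, hx₀⟩ : ∃ x₀, vacSection γ (ϖ g₀) f x₀ ≠ 0 := by
    by_contra h0; push Not at h0; exact hN0 (SchwartzMap.ext h0)
  have hA : Continuous fun g => ω g f x₀ := hcoef f x₀
  have hB : Continuous fun g => vacSection γ (ϖ g) f x₀ :=
    (continuous_schwartz_eval x₀).comp ((D.continuous_apply_vacSection f).comp hϖ)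
  have hAB : ∀ g, c g * vacSection γ (ϖ g) f x₀ = ω g f x₀ := fun g => by
    rw [hcω g f, smul_apply, smul_eq_mul]
  have hne : ∀ᶠ g in nhds g₀, vacSection γ (ϖ g) f x₀ ≠ 0 := hB.continuousAt.eventually_ne hx₀
  refine (hA.continuousAt.div hB.continuousAt hx₀).congr ?_
  filter_upwards [hne] with g hg
  exact (eq_div_of_mul_eq hg (hAB g)).symm

/-- **(w1), joint form**: with a continuous coefficient, `(g, f) ↦ ω g f = c(g) • vacSection γ (ϖ g) f` is
continuous `G × 𝓢 → 𝓢`. [cite: Folland1989, §4.2, the Schur remark p. 156] -/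
theorem continuous_uncurry_of_coeff_fn (D : KAKImplementerData γ κ a WK WA) (ω : Representation ℂ G (SchwartzMap (σ → ℝ) ℂ))
    (ϖ : G → G') (hϖ : Continuous ϖ)
    {c : G → ℂ} (hcω : ∀ (g : G) (f : SchwartzMap (σ → ℝ) ℂ), ω g f = c g • vacSection γ (ϖ g) f)
    (hcoef : ∀ (f : SchwartzMap (σ → ℝ) ℂ) (x : σ → ℝ), Continuous fun g => ω g f x) :
    Continuous fun x : G × SchwartzMap (σ → ℝ) ℂ => ω x.1 x.2 := by
  have h1 : (fun x : G × SchwartzMap (σ → ℝ) ℂ => ω x.1 x.2) = fun x => c x.1 • vacSection γ (ϖ x.1) x.2 :=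
    funext fun x => hcω x.1 x.2
  rw [h1]
  exact ((continuous_coeff D ω ϖ hϖ hcω hcoef).comp continuous_fst).smul
    (D.continuous_uncurry_vacSection.comp ((hϖ.comp continuous_fst).prodMk continuous_snd))

/-- **(w1), joint form, from pointwise coefficient continuity**: `(g, f) ↦ ω g f` is continuous `G × 𝓢 → 𝓢`.
[cite: Folland1989, §4.2, the Schur remark p. 156] -/
theorem continuous_uncurry_of_coeff (D : KAKImplementerData γ κ a WK WA) (ω : Representation ℂ G (SchwartzMap (σ → ℝ) ℂ))
    (hc : ∀ g, Continuous (ω g)) (ϖ : G → G') (hϖ : Continuous ϖ)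
    (hcov : IsPhaseCovariantS (fun g => γ (ϖ g)) (fun g => ω g))
    (hcoef : ∀ (f : SchwartzMap (σ → ℝ) ℂ) (x : σ → ℝ), Continuous fun g => ω g f x) :
    Continuous fun x : G × SchwartzMap (σ → ℝ) ℂ => ω x.1 x.2 := by
  obtain ⟨c, hcω⟩ := exists_coeff D ω hc ϖ hcov
  exact continuous_uncurry_of_coeff_fn D ω ϖ hϖ hcω hcoef

/-- **(w1) from pointwise coefficient continuity**: every orbit map `g ↦ ω g f` of a representation with continuous
operators, Heisenberg-covariant over `γ ∘ ϖ` for `KAK` implementer data `γ`, whose matrix coefficients at points are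
continuous, is continuous into the Fréchet space `𝓢(ℝ^σ)`. [cite: Folland1989, §4.2, the Schur remark p. 156] -/
theorem continuous_apply_of_coeff (D : KAKImplementerData γ κ a WK WA) (ω : Representation ℂ G (SchwartzMap (σ → ℝ) ℂ))
    (hc : ∀ g, Continuous (ω g)) (ϖ : G → G') (hϖ : Continuous ϖ)
    (hcov : IsPhaseCovariantS (fun g => γ (ϖ g)) (fun g => ω g))
    (hcoef : ∀ (f : SchwartzMap (σ → ℝ) ℂ) (x : σ → ℝ), Continuous fun g => ω g f x) (f : SchwartzMap (σ → ℝ) ℂ) :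
    Continuous fun g => ω g f :=
  (continuous_uncurry_of_coeff D ω hc ϖ hϖ hcov hcoef).comp (continuous_id.prodMk continuous_const)

/-! ## 5. The modulus character `g ↦ ‖c g‖` -/

omit [TopologicalSpace G] in
/-- **Multiplicativity of the modulus**: if the phase maps `g ↦ γ (ϖ g)` are multiplicative then
`‖c(g h)‖ = ‖c g‖ ‖c h‖` — `vacSection (ϖ g) ∘ vacSection (ϖ h)` and `vacSection (ϖ (g h))` implement the same
map with unitary lifts, so they differ by a unimodular scalar. [cite: Folland1989, §4.2, (4.24) and the Schur remark p. 156] -/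
theorem norm_coeff_mul (D : KAKImplementerData γ κ a WK WA) (ω : Representation ℂ G (SchwartzMap (σ → ℝ) ℂ)) (ϖ : G → G')
    {c : G → ℂ} (hcω : ∀ (g : G) (f : SchwartzMap (σ → ℝ) ℂ), ω g f = c g • vacSection γ (ϖ g) f)
    (hmul : ∀ (g h : G) (pq : (σ → ℝ) × (σ → ℝ)), γ (ϖ (g * h)) pq = γ (ϖ g) (γ (ϖ h) pq)) (g h : G) :
    ‖c (g * h)‖ = ‖c g‖ * ‖c h‖ := by
  have hγ : γ (ϖ (g * h)) = γ (ϖ g) ∘ γ (ϖ h) := funext (hmul g h)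
  have hI : IsImplementerS (γ (ϖ (g * h))) ((vacSection γ (ϖ g)).comp (vacSection γ (ϖ h))) := by
    rw [hγ]; exact (D.isImplementerS_vacSection (ϖ g)).comp (D.isImplementerS_vacSection (ϖ h))
  obtain ⟨e, he, hcomp⟩ := (D.isImplementerS_vacSection (ϖ (g * h))).exists_eq_smul hI
  have hcomp' : ∀ f : SchwartzMap (σ → ℝ) ℂ,
      vacSection γ (ϖ g) (vacSection γ (ϖ h) f) = e • vacSection γ (ϖ (g * h)) f :=
    fun f => by rw [← ContinuousLinearMap.comp_apply, hcomp, FunLike.coe_smul, Pi.smul_apply]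
  have h1 : ω (g * h) (hermitePi 0) = (c g * c h * e) • vacSection γ (ϖ (g * h)) (hermitePi 0) := by
    rw [map_mul, Module.End.mul_apply, hcω h (hermitePi 0), map_smul, hcω g, hcomp', smul_smul, smul_smul]
    congr 1
    ring
  rw [← eq_coeff D ω ϖ hcω hermitePi_zero_ne_zero h1, norm_mul, norm_mul, he, mul_one]

omit [TopologicalSpace G] [Monoid G'] [TopologicalSpace G'] in
/-- `0 < ‖c g‖`. [folklore] -/
theorem norm_coeff_pos (ω : Representation ℂ G (SchwartzMap (σ → ℝ) ℂ)) (ϖ : G → G')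
    {c : G → ℂ} (hcω : ∀ (g : G) (f : SchwartzMap (σ → ℝ) ℂ), ω g f = c g • vacSection γ (ϖ g) f) (g : G) : 0 < ‖c g‖ :=
  norm_pos_iff.2 (coeff_ne_zero ω ϖ hcω g)

omit [TopologicalSpace G] in
/-- `‖c 1‖ = 1`. [cite: Folland1989, §4.2, the Schur remark p. 156] -/
theorem norm_coeff_one (D : KAKImplementerData γ κ a WK WA) (ω : Representation ℂ G (SchwartzMap (σ → ℝ) ℂ)) (ϖ : G → G')
    {c : G → ℂ} (hcω : ∀ (g : G) (f : SchwartzMap (σ → ℝ) ℂ), ω g f = c g • vacSection γ (ϖ g) f)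
    (hmul : ∀ (g h : G) (pq : (σ → ℝ) × (σ → ℝ)), γ (ϖ (g * h)) pq = γ (ϖ g) (γ (ϖ h) pq)) : ‖c 1‖ = 1 :=
  mulPos_map_one (norm_coeff_mul D ω ϖ hcω hmul) (norm_coeff_pos ω ϖ hcω)

/-! ## 6. (w2′) ⇔ `‖c‖ = 1`; the datum -/

omit [TopologicalSpace G] in
/-- **(w2′) at `g` from `‖c g‖ = 1`**: a unimodular multiple of the (unitarily liftable) section has a unitary lift.
[cite: Folland1989, §4.2, the Schur remark p. 156] -/
theorem hasUnitaryLift_of_norm_coeff (D : KAKImplementerData γ κ a WK WA) (ω : Representation ℂ G (SchwartzMap (σ → ℝ) ℂ))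
    (ϖ : G → G') {c : G → ℂ} (hcω : ∀ (g : G) (f : SchwartzMap (σ → ℝ) ℂ), ω g f = c g • vacSection γ (ϖ g) f)
    {g : G} (hg : ‖c g‖ = 1) :
    (∃ U : Lp ℂ 2 (volume : Measure (σ → ℝ)) ≃ₗᵢ[ℂ] Lp ℂ 2 (volume : Measure (σ → ℝ)),
      LiftsTo (ω g) ((U.toContinuousLinearEquiv : Lp ℂ 2 (volume : Measure (σ → ℝ)) ≃L[ℂ]
        Lp ℂ 2 (volume : Measure (σ → ℝ))) : Lp ℂ 2 (volume : Measure (σ → ℝ)) →L[ℂ] Lp ℂ 2 (volume : Measure (σ → ℝ)))) := by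
  obtain ⟨U, hU⟩ := ((D.isImplementerS_vacSection (ϖ g)).smul hg).2
  refine ⟨U, fun f => ?_⟩
  rw [← hU f]
  simp only [ContinuousLinearMap.coe_coe, FunLike.coe_smul, Pi.smul_apply]
  rw [hcω g f]

omit [TopologicalSpace G] in
/-- Conversely (w2′) at `g` forces `‖c g‖ = 1` (two implementers with unitary lifts differ by a unimodular scalar).
[cite: Folland1989, §4.2, the Schur remark p. 156] -/
theorem norm_coeff_of_hasUnitaryLift (D : KAKImplementerData γ κ a WK WA) (ω : Representation ℂ G (SchwartzMap (σ → ℝ) ℂ))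
    (hc : ∀ g, Continuous (ω g)) (ϖ : G → G') (hcov : IsPhaseCovariantS (fun g => γ (ϖ g)) (fun g => ω g))
    {c : G → ℂ} (hcω : ∀ (g : G) (f : SchwartzMap (σ → ℝ) ℂ), ω g f = c g • vacSection γ (ϖ g) f) {g : G}
    (hg : (∃ U : Lp ℂ 2 (volume : Measure (σ → ℝ)) ≃ₗᵢ[ℂ] Lp ℂ 2 (volume : Measure (σ → ℝ)),
      LiftsTo (ω g) ((U.toContinuousLinearEquiv : Lp ℂ 2 (volume : Measure (σ → ℝ)) ≃L[ℂ]
        Lp ℂ 2 (volume : Measure (σ → ℝ))) : Lp ℂ 2 (volume : Measure (σ → ℝ)) →L[ℂ] Lp ℂ 2 (volume : Measure (σ → ℝ))))) :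
    ‖c g‖ = 1 := by
  obtain ⟨M, hM⟩ := exists_continuousLinearEquiv_coe_eq ω hc g
  have hMI : IsImplementerS (γ (ϖ g)) (M : (SchwartzMap (σ → ℝ) ℂ) →L[ℂ] SchwartzMap (σ → ℝ) ℂ) := by
    refine ⟨fun p q f => ?_, ?_⟩
    · simp only [ContinuousLinearEquiv.coe_coe, hM]; exact hcov g p q f
    · obtain ⟨U, hU⟩ := hg
      refine ⟨U, fun f => ?_⟩
      rw [← hU f]
      simp only [ContinuousLinearMap.coe_coe, ContinuousLinearEquiv.coe_coe, hM]
  obtain ⟨e, he, hMe⟩ := (D.isImplementerS_vacSection (ϖ g)).exists_eq_smul hMI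
  have h1 : ω g (hermitePi 0) = e • vacSection γ (ϖ g) (hermitePi 0) := by
    rw [← hM, ← ContinuousLinearEquiv.coe_coe, hMe, FunLike.coe_smul, Pi.smul_apply]
  rw [← eq_coeff D ω ϖ hcω hermitePi_zero_ne_zero h1, he]

/-- **(w2′) everywhere from the triviality of continuous positive multiplicative functions on `G`** (applied to
`‖c‖`). [cite: Folland1989, §4.2, the Schur remark p. 156] -/
theorem hasUnitaryLift_of_coeff (D : KAKImplementerData γ κ a WK WA) (ω : Representation ℂ G (SchwartzMap (σ → ℝ) ℂ))
    (hc : ∀ g, Continuous (ω g)) (ϖ : G → G') (hϖ : Continuous ϖ)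
    (hcov : IsPhaseCovariantS (fun g => γ (ϖ g)) (fun g => ω g))
    (hcoef : ∀ (f : SchwartzMap (σ → ℝ) ℂ) (x : σ → ℝ), Continuous fun g => ω g f x)
    (hmul : ∀ (g h : G) (pq : (σ → ℝ) × (σ → ℝ)), γ (ϖ (g * h)) pq = γ (ϖ g) (γ (ϖ h) pq))
    (htriv : ∀ n : G → ℝ, (∀ g h, n (g * h) = n g * n h) → (∀ g, 0 < n g) → Continuous n → ∀ g, n g = 1)
    (g : G) :
    (∃ U : Lp ℂ 2 (volume : Measure (σ → ℝ)) ≃ₗᵢ[ℂ] Lp ℂ 2 (volume : Measure (σ → ℝ)),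
      LiftsTo (ω g) ((U.toContinuousLinearEquiv : Lp ℂ 2 (volume : Measure (σ → ℝ)) ≃L[ℂ]
        Lp ℂ 2 (volume : Measure (σ → ℝ))) : Lp ℂ 2 (volume : Measure (σ → ℝ)) →L[ℂ] Lp ℂ 2 (volume : Measure (σ → ℝ)))) := by
  obtain ⟨c, hcω⟩ := exists_coeff D ω hc ϖ hcov
  exact hasUnitaryLift_of_norm_coeff D ω ϖ hcω
    (htriv (fun g => ‖c g‖) (norm_coeff_mul D ω ϖ hcω hmul) (norm_coeff_pos ω ϖ hcω)
      (continuous_norm.comp (continuous_coeff D ω ϖ hϖ hcω hcoef)) g)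

omit [DecidableEq σ] [TopologicalSpace G] [Monoid G'] [TopologicalSpace G'] in
/-- The phase maps of a homomorphism into the symplectic group are multiplicative (dictionary form). [folklore] -/
theorem phaseMap_mul_of_hom (ι𝕎 : G →* symplecticGroup (polar (dotPairing σ))) (ϖ : G → G')
    (hdict : ∀ (g : G) (pq : (σ → ℝ) × (σ → ℝ)),
      γ (ϖ g) pq = ((ι𝕎 g).1 : ((σ → ℝ) × (σ → ℝ)) ≃ₗ[ℝ] (σ → ℝ) × (σ → ℝ)) pq)
    (g h : G) (pq : (σ → ℝ) × (σ → ℝ)) : γ (ϖ (g * h)) pq = γ (ϖ g) (γ (ϖ h) pq) := by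
  rw [hdict, hdict, hdict, map_mul]; rfl

/-- **The archimedean Weil datum of a coefficient-continuous covariant representation.**  Let `ω` be a
representation of a topological group `G` on `𝓢(ℝ^σ)` with continuous operators, Heisenberg-covariant over
`ι𝕎 : G →* Sp(ℝ^σ × ℝ^σ)`, whose matrix coefficients at points `g ↦ (ω g f)(x)` are continuous; let `KAK`
implementer data for a phase action `γ` of a monoid `G′` and a continuous `ϖ : G → G′` with `⇑(ι𝕎 g) = γ (ϖ g)` be
given; and suppose `G` carries no non-trivial continuous positive multiplicative function.  Then
`IsArchWeilDatum ι𝕎 ω`: (w1) by §4, (w2′) by §2, §5–§6. [cite: Folland1989, §4.2, the Schur remark p. 156] -/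
theorem isArchWeilDatum_of_coeff (D : KAKImplementerData γ κ a WK WA)
    {ι𝕎 : G →* symplecticGroup (polar (dotPairing σ))} {ω : Representation ℂ G (SchwartzMap (σ → ℝ) ℂ)}
    (hc : ∀ g, Continuous (ω g)) (ϖ : G → G') (hϖ : Continuous ϖ)
    (hdict : ∀ (g : G) (pq : (σ → ℝ) × (σ → ℝ)),
      γ (ϖ g) pq = ((ι𝕎 g).1 : ((σ → ℝ) × (σ → ℝ)) ≃ₗ[ℝ] (σ → ℝ) × (σ → ℝ)) pq)
    (hcov : IsPhaseCovariantS (fun g => ⇑((ι𝕎 g).1 : ((σ → ℝ) × (σ → ℝ)) ≃ₗ[ℝ] (σ → ℝ) × (σ → ℝ)))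
      (fun g => ω g))
    (hcoef : ∀ (f : SchwartzMap (σ → ℝ) ℂ) (x : σ → ℝ), Continuous fun g => ω g f x)
    (htriv : ∀ n : G → ℝ, (∀ g h, n (g * h) = n g * n h) → (∀ g, 0 < n g) → Continuous n → ∀ g, n g = 1) :
    IsArchWeilDatum ι𝕎 ω := by
  have hcov' : IsPhaseCovariantS (fun g => γ (ϖ g)) (fun g => ω g) := fun g p q f => by
    have h1 := hcov g p q f
    dsimp only at h1 ⊢
    rw [hdict]; exact h1
  exact
    { continuous_apply := continuous_apply_of_coeff D ω hc ϖ hϖ hcov' hcoef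
      covariant := hcov
      exists_lift :=
        hasUnitaryLift_of_coeff D ω hc ϖ hϖ hcov' hcoef (phaseMap_mul_of_hom ι𝕎 ϖ hdict) htriv }

/-- **(w1) alone, over `ι𝕎`** (no hypothesis on positive characters): the orbit maps of `ω` are continuous.
[cite: Folland1989, §4.2, the Schur remark p. 156] -/
theorem continuous_apply_of_coeff_hom (D : KAKImplementerData γ κ a WK WA)
    {ι𝕎 : G →* symplecticGroup (polar (dotPairing σ))} {ω : Representation ℂ G (SchwartzMap (σ → ℝ) ℂ)}
    (hc : ∀ g, Continuous (ω g)) (ϖ : G → G') (hϖ : Continuous ϖ)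
    (hdict : ∀ (g : G) (pq : (σ → ℝ) × (σ → ℝ)),
      γ (ϖ g) pq = ((ι𝕎 g).1 : ((σ → ℝ) × (σ → ℝ)) ≃ₗ[ℝ] (σ → ℝ) × (σ → ℝ)) pq)
    (hcov : IsPhaseCovariantS (fun g => ⇑((ι𝕎 g).1 : ((σ → ℝ) × (σ → ℝ)) ≃ₗ[ℝ] (σ → ℝ) × (σ → ℝ)))
      (fun g => ω g))
    (hcoef : ∀ (f : SchwartzMap (σ → ℝ) ℂ) (x : σ → ℝ), Continuous fun g => ω g f x) (f : SchwartzMap (σ → ℝ) ℂ) :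
    Continuous fun g => ω g f := by
  have hcov' : IsPhaseCovariantS (fun g => γ (ϖ g)) (fun g => ω g) := fun g p q f => by
    have h1 := hcov g p q f
    dsimp only at h1 ⊢
    rw [hdict]; exact h1
  exact continuous_apply_of_coeff D ω hc ϖ hϖ hcov' hcoef f

end Coeff


end Literature.NumberTheory.Weil1964
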